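import Mathlib
import Literature.Computability.Complexity.CNF
import Summits.PneNP.PneNP.Theorems.OverlapGapAlgebraSearchHardWindowAffineRungCount

/-!
# PneNP / OverlapGapAlgebra — `SearchHardWindow`: the ALGEBRAIC (sign-affine) rung (3/3) —
# families, rates, and the rung in the crux's language

Support for crux `stmt-PneNP-2460` (`Summit.PneNP.PneNP.Theses.OverlapGapAlgebra.SearchHardWindow`)
and the calibration of crux `stmt-PneNP-2463` (`…SolvableImpliesStableSection`). Sequel of
`…AffineRungCore` / `…AffineRungCount` (`shwAff_successCount_le`: a sign-affine search map solves
at most `(1 - 2^{-k})^{m-n} #Inst` instances of `F_k(n, m)`).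

* `shwAff_successCount_family_le` — a family of `M` sign-affine maps (adaptive branching on
  `log₂ M` arbitrary, even uncomputable, bits of the instance, then a GF(2)-affine rule) solves
  `≤ M (1 - 2^{-k})^{m-n} #Inst` instances in total;
* `shwAff_ratio_le`, `shwAff_pow_le_exp` — ratio form `≤ (1 - 2^{-k})^{m-n} ≤ e^{-(m-n)/2^k}`;
* `shwAff_successCount_le_of_card_image`, `shwAff_fewOutputsFail` — the output-entropy by-product:
  a map with `M` distinct outputs solves `≤ M (1 - 2^{-k})^m #Inst`; `≤ e^{cn}` outputs, `c < α/2^k`, fail;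
* `shwAff_tendsto_pow`, `shwAff_affineMapsFail` — THE RUNG (abstract maps): for every `k` and
  every density `α > 1`, sign-affine maps eventually solve at most an `ε`-fraction of
  `F_k(n, ⌊α n⌋)`, uniformly in the map — the window `α_k = 5·2^k log k/k` (`k ≥ 2`) included, but
  also the whole satisfiable phase above `α = 1`, where stable algorithms DO succeed: the algebraic
  class fails for a reason orthogonal to the overlap-gap property;
* `shwAff_familyMapsFail` — `e^{cn}` affine strategies, `c < (α-1)/2^k`, still fail;
* `shwAff_hardnessConjunct_of_signAffine` — the hardness conjunct of `SearchHardWindow`, verbatim,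
  for ANY `f : List Bool → List Bool` (no complexity hypothesis) whose decoded assignment is
  eventually sign-affine, at every `(k, α)` with `α > 1`; `shwAff_hardnessConjunct_window` — the same
  at the route's window density `α_k = 5·2^k log k / k` for every `k ≥ 2`
  (`shwAff_one_lt_windowDensity`);
* `shwAff_not_solvable_of_signAffine` — the hypothesis `Solvable k α` of `SolvableImpliesStableSection`
  has no sign-affine witness at any `α > 1` (for the algebraic class the transfer is owed only at `α ≤ 1`).
No definitions; axioms `propext`, `Classical.choice`, `Quot.sound`.
-/

set_option linter.dupNamespace false -- `Summit.PneNP.PneNP.…`: summit = sub-problem (D-0017)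

namespace Summit.PneNP.PneNP.Theorems

open Finset Filter
open scoped Classical

section Families

variable {m k n : ℕ}

/-- **Families of sign-affine maps** (adaptive branching on `log₂ M` arbitrary bits of the
instance, then an affine rule): `#{Φ : some g_a satisfies Φ} ≤ M · (1 - 2^{-k})^{m - n} · #Inst`. -/
theorem shwAff_successCount_family_le {M : ℕ}
    (g : Fin M → (Fin m → Fin k → Fin n × Bool) → (Fin n → Bool))
    (hg : ∀ a (S : Fin m → Fin k → Fin n) (x y z : Fin m → Fin k → Bool) (v : Fin n),
      g a (fun i j => (S i j, (x i j ^^ y i j) ^^ z i j)) v =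
        ((g a (fun i j => (S i j, x i j)) v ^^ g a (fun i j => (S i j, y i j)) v) ^^
          g a (fun i j => (S i j, z i j)) v)) :
    (((univ : Finset (Fin m → Fin k → Fin n × Bool)).filter fun Φ =>
        ∃ a, ∀ i, ∃ j, g a Φ (Φ i j).1 = (Φ i j).2).card : ℝ) ≤
      M * ((1 - (2 : ℝ)⁻¹ ^ k) ^ (m - n) * Fintype.card (Fin m → Fin k → Fin n × Bool)) := by
  have hsub : ((univ : Finset (Fin m → Fin k → Fin n × Bool)).filter fun Φ =>
        ∃ a, ∀ i, ∃ j, g a Φ (Φ i j).1 = (Φ i j).2) ⊆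
      (univ : Finset (Fin M)).biUnion fun a =>
        (univ : Finset (Fin m → Fin k → Fin n × Bool)).filter fun Φ =>
          ∀ i, ∃ j, g a Φ (Φ i j).1 = (Φ i j).2 := by
    intro Φ hΦ
    simp only [mem_filter, mem_univ, true_and] at hΦ
    simp only [mem_biUnion, mem_univ, true_and, mem_filter]
    exact hΦ
  calc (((univ : Finset (Fin m → Fin k → Fin n × Bool)).filter fun Φ =>
          ∃ a, ∀ i, ∃ j, g a Φ (Φ i j).1 = (Φ i j).2).card : ℝ)
      ≤ (((univ : Finset (Fin M)).biUnion fun a =>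
          (univ : Finset (Fin m → Fin k → Fin n × Bool)).filter fun Φ =>
            ∀ i, ∃ j, g a Φ (Φ i j).1 = (Φ i j).2).card : ℝ) := by
        exact_mod_cast card_le_card hsub
    _ ≤ ∑ a : Fin M, (((univ : Finset (Fin m → Fin k → Fin n × Bool)).filter fun Φ =>
            ∀ i, ∃ j, g a Φ (Φ i j).1 = (Φ i j).2).card : ℝ) := by
        exact_mod_cast card_biUnion_le
    _ ≤ ∑ _a : Fin M, (1 - (2 : ℝ)⁻¹ ^ k) ^ (m - n) *
          (Fintype.card (Fin m → Fin k → Fin n × Bool) : ℝ) :=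
        sum_le_sum fun a _ => shwAff_successCount_le (g a) (hg a)
    _ = _ := by rw [sum_const, card_univ, Fintype.card_fin, nsmul_eq_mul]

/-- The success RATIO of a sign-affine map is at most `(1 - 2^{-k})^{m - n}` (`n ≥ 1`). -/
theorem shwAff_ratio_le (hn : 1 ≤ n) (g : (Fin m → Fin k → Fin n × Bool) → (Fin n → Bool))
    (hg : ∀ (S : Fin m → Fin k → Fin n) (x y z : Fin m → Fin k → Bool) (v : Fin n),
      g (fun i j => (S i j, (x i j ^^ y i j) ^^ z i j)) v =
        ((g (fun i j => (S i j, x i j)) v ^^ g (fun i j => (S i j, y i j)) v) ^^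
          g (fun i j => (S i j, z i j)) v)) :
    (((univ : Finset (Fin m → Fin k → Fin n × Bool)).filter fun Φ =>
        ∀ i, ∃ j, g Φ (Φ i j).1 = (Φ i j).2).card : ℝ) /
        Fintype.card (Fin m → Fin k → Fin n × Bool) ≤ (1 - (2 : ℝ)⁻¹ ^ k) ^ (m - n) := by
  have hpos : (0 : ℝ) < Fintype.card (Fin m → Fin k → Fin n × Bool) := by
    have : 0 < n := hn
    have : Nonempty (Fin n) := ⟨⟨0, this⟩⟩
    exact_mod_cast Fintype.card_pos
  rw [div_le_iff₀ hpos]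
  exact shwAff_successCount_le g hg

/-- The exponential form of the bound: `(1 - 2^{-k})^{m - n} ≤ e^{-(m - n)/2^k}`. -/
theorem shwAff_pow_le_exp (k d : ℕ) :
    (1 - (2 : ℝ)⁻¹ ^ k) ^ d ≤ Real.exp (-(d : ℝ) / 2 ^ k) := by
  have hρ0 : (0 : ℝ) ≤ 1 - (2 : ℝ)⁻¹ ^ k := by
    rw [sub_nonneg]
    exact pow_le_one₀ (by norm_num) (by norm_num)
  calc (1 - (2 : ℝ)⁻¹ ^ k) ^ d ≤ (Real.exp (-(2 : ℝ)⁻¹ ^ k)) ^ d :=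
        pow_le_pow_left₀ hρ0 (Real.one_sub_le_exp_neg _) d
    _ = Real.exp (-(d : ℝ) / 2 ^ k) := by
        rw [← Real.exp_nat_mul, inv_pow]
        congr 1
        ring

/-- **Few distinct outputs (the output-entropy bound).** Any search map with at most `M` distinct
output assignments solves at most `M (1 - 2^{-k})^m #Inst` instances: a constant map is sign-affine
with NO sign-dependent output bit. -/
theorem shwAff_successCount_le_of_card_image (g : (Fin m → Fin k → Fin n × Bool) → (Fin n → Bool))
    (M : ℕ) (hM : ((univ : Finset (Fin m → Fin k → Fin n × Bool)).image g).card ≤ M) :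
    (((univ : Finset (Fin m → Fin k → Fin n × Bool)).filter fun Φ =>
        ∀ i, ∃ j, g Φ (Φ i j).1 = (Φ i j).2).card : ℝ) ≤
      M * ((1 - (2 : ℝ)⁻¹ ^ k) ^ m * Fintype.card (Fin m → Fin k → Fin n × Bool)) := by
  set T : Finset (Fin n → Bool) := (univ : Finset (Fin m → Fin k → Fin n × Bool)).image g with hT
  have hconst : ∀ σ : Fin n → Bool, (((univ : Finset (Fin m → Fin k → Fin n × Bool)).filter fun Φ =>
      ∀ i, ∃ j, σ (Φ i j).1 = (Φ i j).2).card : ℝ) ≤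
        (1 - (2 : ℝ)⁻¹ ^ k) ^ m * Fintype.card (Fin m → Fin k → Fin n × Bool) := by
    intro σ
    have key := shwAff_successCount_le_of_dep (m := m) (k := k) (n := n) 0 (fun _ => σ)
      (fun S x y z v => by cases σ v <;> rfl) (fun S => by simp)
    rwa [Nat.sub_zero] at key
  have hsub : ((univ : Finset (Fin m → Fin k → Fin n × Bool)).filter fun Φ =>
        ∀ i, ∃ j, g Φ (Φ i j).1 = (Φ i j).2) ⊆
      T.biUnion fun σ => (univ : Finset (Fin m → Fin k → Fin n × Bool)).filter fun Φ =>
        ∀ i, ∃ j, σ (Φ i j).1 = (Φ i j).2 := by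
    intro Φ hΦ
    simp only [mem_filter, mem_univ, true_and] at hΦ
    simp only [mem_biUnion, mem_filter, mem_univ, true_and, hT, mem_image]
    exact ⟨g Φ, ⟨Φ, rfl⟩, hΦ⟩
  calc (((univ : Finset (Fin m → Fin k → Fin n × Bool)).filter fun Φ =>
          ∀ i, ∃ j, g Φ (Φ i j).1 = (Φ i j).2).card : ℝ)
      ≤ ((T.biUnion fun σ => (univ : Finset (Fin m → Fin k → Fin n × Bool)).filter fun Φ =>
          ∀ i, ∃ j, σ (Φ i j).1 = (Φ i j).2).card : ℝ) := by
        exact_mod_cast card_le_card hsub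
    _ ≤ ∑ σ ∈ T, (((univ : Finset (Fin m → Fin k → Fin n × Bool)).filter fun Φ =>
          ∀ i, ∃ j, σ (Φ i j).1 = (Φ i j).2).card : ℝ) := by
        exact_mod_cast card_biUnion_le
    _ ≤ ∑ _σ ∈ T, (1 - (2 : ℝ)⁻¹ ^ k) ^ m * (Fintype.card (Fin m → Fin k → Fin n × Bool) : ℝ) :=
        sum_le_sum fun σ _ => hconst σ
    _ = T.card * ((1 - (2 : ℝ)⁻¹ ^ k) ^ m * Fintype.card (Fin m → Fin k → Fin n × Bool)) := by
        rw [sum_const, nsmul_eq_mul]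
    _ ≤ M * ((1 - (2 : ℝ)⁻¹ ^ k) ^ m * Fintype.card (Fin m → Fin k → Fin n × Bool)) := by
        have h0 : (0 : ℝ) ≤ (1 - (2 : ℝ)⁻¹ ^ k) ^ m *
            Fintype.card (Fin m → Fin k → Fin n × Bool) := by
          apply mul_nonneg (pow_nonneg ?_ _) (Nat.cast_nonneg _)
          rw [sub_nonneg]
          exact pow_le_one₀ (by norm_num) (by norm_num)
        exact mul_le_mul_of_nonneg_right (by exact_mod_cast hM) h0

end Families

section Asymptotic

open Literature.Computability.Complexity

/-- For `α > 1`, `(1 - 2^{-k})^{⌊α n⌋₊ - n} → 0`. -/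
theorem shwAff_tendsto_pow (k : ℕ) {α : ℝ} (hα : 1 < α) :
    Tendsto (fun n : ℕ => (1 - (2 : ℝ)⁻¹ ^ k) ^ (⌊α * n⌋₊ - n)) atTop (nhds 0) := by
  have hρ0 : (0 : ℝ) ≤ 1 - (2 : ℝ)⁻¹ ^ k := by
    rw [sub_nonneg]
    exact pow_le_one₀ (by norm_num) (by norm_num)
  have hρ1 : 1 - (2 : ℝ)⁻¹ ^ k < 1 := sub_lt_self _ (by positivity)
  have hexp : Tendsto (fun n : ℕ => ⌊α * n⌋₊ - n) atTop atTop := by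
    refine tendsto_atTop_atTop.2 fun M => ⟨⌈(M + 1) / (α - 1)⌉₊, fun n hn => ?_⟩
    have hα1 : 0 < α - 1 := sub_pos.2 hα
    have hn' : (M + 1) / (α - 1) ≤ n := (Nat.le_ceil _).trans (by exact_mod_cast hn)
    rw [div_le_iff₀ hα1] at hn'
    have hle : ((n + M : ℕ) : ℝ) ≤ α * n := by
      push_cast
      nlinarith
    have := Nat.le_floor hle
    omega
  exact (tendsto_pow_atTop_nhds_zero_of_lt_one hρ0 hρ1).comp hexp

/-- **The algebraic rung (abstract maps).** For every `k` and every density `α > 1`, every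
sign-affine search map eventually solves at most an `ε`-fraction of `F_k(n, ⌊α n⌋)` — uniformly in
the map. -/
theorem shwAff_affineMapsFail (k : ℕ) {α : ℝ} (hα : 1 < α) (ε : ℝ) (hε : 0 < ε) :
    ∀ᶠ n : ℕ in atTop, ∀ m : ℕ, m = ⌊α * n⌋₊ →
      ∀ g : (Fin m → Fin k → Fin n × Bool) → (Fin n → Bool),
        (∀ (S : Fin m → Fin k → Fin n) (x y z : Fin m → Fin k → Bool) (v : Fin n),
          g (fun i j => (S i j, (x i j ^^ y i j) ^^ z i j)) v =
            ((g (fun i j => (S i j, x i j)) v ^^ g (fun i j => (S i j, y i j)) v) ^^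
              g (fun i j => (S i j, z i j)) v)) →
        (((univ : Finset (Fin m → Fin k → Fin n × Bool)).filter fun Φ =>
            ∀ i, ∃ j, g Φ (Φ i j).1 = (Φ i j).2).card : ℝ) /
          Fintype.card (Fin m → Fin k → Fin n × Bool) ≤ ε := by
  filter_upwards [(shwAff_tendsto_pow k hα).eventually (ge_mem_nhds hε), eventually_ge_atTop 1]
    with n hsmall hn1
  intro m hm g hg
  refine (shwAff_ratio_le hn1 g hg).trans ?_
  rw [hm]
  exact hsmall

/-- **Exponentially many affine strategies fail.** For `α > 1` and `c < (α - 1)/2^k`, families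
of at most `e^{c n}` sign-affine maps — equivalently: branch adaptively on `c n / log 2` arbitrary
(even uncomputable) bits of the instance, then apply a GF(2)-affine rule — eventually solve at
most an `ε`-fraction of `F_k(n, ⌊α n⌋)`, even when the instance may pick the successful member. -/
theorem shwAff_familyMapsFail (k : ℕ) {α c : ℝ} (hα : 1 < α) (hc : c < (α - 1) / 2 ^ k)
    (ε : ℝ) (hε : 0 < ε) :
    ∀ᶠ n : ℕ in atTop, ∀ m : ℕ, m = ⌊α * n⌋₊ → ∀ M : ℕ, (M : ℝ) ≤ Real.exp (c * n) →
      ∀ g : Fin M → (Fin m → Fin k → Fin n × Bool) → (Fin n → Bool),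
        (∀ a (S : Fin m → Fin k → Fin n) (x y z : Fin m → Fin k → Bool) (v : Fin n),
          g a (fun i j => (S i j, (x i j ^^ y i j) ^^ z i j)) v =
            ((g a (fun i j => (S i j, x i j)) v ^^ g a (fun i j => (S i j, y i j)) v) ^^
              g a (fun i j => (S i j, z i j)) v)) →
        (((univ : Finset (Fin m → Fin k → Fin n × Bool)).filter fun Φ =>
            ∃ a, ∀ i, ∃ j, g a Φ (Φ i j).1 = (Φ i j).2).card : ℝ) /
          Fintype.card (Fin m → Fin k → Fin n × Bool) ≤ ε := by
  have h2k : (0 : ℝ) < 2 ^ k := by positivity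
  have hκ : c - (α - 1) / 2 ^ k < 0 := by linarith
  have hlin : Tendsto (fun n : ℕ => (2 : ℝ)⁻¹ ^ k + (c - (α - 1) / 2 ^ k) * n) atTop atBot :=
    tendsto_atBot_add_const_left _ _
      ((tendsto_natCast_atTop_atTop (R := ℝ)).const_mul_atTop_of_neg hκ)
  have hexp := (Real.tendsto_exp_atBot.comp hlin).eventually (ge_mem_nhds hε)
  filter_upwards [hexp, eventually_ge_atTop 1] with n hsmall hn1
  intro m hm M hM g hg
  have hpos : (0 : ℝ) < Fintype.card (Fin m → Fin k → Fin n × Bool) := by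
    have : 0 < n := hn1
    have : Nonempty (Fin n) := ⟨⟨0, this⟩⟩
    exact_mod_cast Fintype.card_pos
  rw [div_le_iff₀ hpos]
  refine (shwAff_successCount_family_le g hg).trans ?_
  rw [← mul_assoc]
  refine mul_le_mul_of_nonneg_right ?_ hpos.le
  -- `M ρ^{m-n} ≤ e^{cn} e^{-(m-n)/2^k} ≤ e^{2^{-k} + (c - (α-1)/2^k) n} ≤ ε`
  have hρ0 : (0 : ℝ) ≤ (1 - (2 : ℝ)⁻¹ ^ k) ^ (m - n) := by
    apply pow_nonneg
    rw [sub_nonneg]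
    exact pow_le_one₀ (by norm_num) (by norm_num)
  have hmn : n ≤ m := by
    rw [hm]
    refine Nat.le_floor ?_
    have : (0 : ℝ) ≤ n := Nat.cast_nonneg n
    nlinarith
  have hsub : (α - 1) * n - 1 ≤ ((m - n : ℕ) : ℝ) := by
    rw [Nat.cast_sub hmn]
    have : α * n < (m : ℝ) + 1 := by
      rw [hm]
      exact Nat.lt_floor_add_one _
    linarith
  calc (M : ℝ) * (1 - (2 : ℝ)⁻¹ ^ k) ^ (m - n)
      ≤ Real.exp (c * n) * Real.exp (-((m - n : ℕ) : ℝ) / 2 ^ k) :=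
        mul_le_mul hM (shwAff_pow_le_exp k (m - n)) hρ0 (Real.exp_pos _).le
    _ ≤ Real.exp (c * n) * Real.exp (-((α - 1) * n - 1) / 2 ^ k) := by
        refine mul_le_mul_of_nonneg_left (Real.exp_le_exp.2 ?_) (Real.exp_pos _).le
        exact div_le_div_of_nonneg_right (by linarith) h2k.le
    _ = Real.exp ((2 : ℝ)⁻¹ ^ k + (c - (α - 1) / 2 ^ k) * n) := by
        rw [← Real.exp_add, inv_pow]
        congr 1
        field_simp
        ring
    _ ≤ ε := hsmall

/-- **The output-entropy rung.** For `c < α / 2^k`, search maps with at most `e^{cn}`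
distinct output assignments (e.g. maps that decide a fixed set of `c n / log 2` variables and fill
in the rest canonically) eventually solve at most an `ε`-fraction of `F_k(n, ⌊α n⌋)`; in the
window `α_k = 5·2^k log k / k` this allows `2^{(5 - δ) n log₂ k / k}` outputs. -/
theorem shwAff_fewOutputsFail (k : ℕ) {α c : ℝ} (hc : c < α / 2 ^ k)
    (ε : ℝ) (hε : 0 < ε) :
    ∀ᶠ n : ℕ in atTop, ∀ m : ℕ, m = ⌊α * n⌋₊ →
      ∀ g : (Fin m → Fin k → Fin n × Bool) → (Fin n → Bool),
        ((((univ : Finset (Fin m → Fin k → Fin n × Bool)).image g).card : ℕ) : ℝ) ≤ Real.exp (c * n) →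
        (((univ : Finset (Fin m → Fin k → Fin n × Bool)).filter fun Φ =>
            ∀ i, ∃ j, g Φ (Φ i j).1 = (Φ i j).2).card : ℝ) /
          Fintype.card (Fin m → Fin k → Fin n × Bool) ≤ ε := by
  have h2k : (0 : ℝ) < 2 ^ k := by positivity
  have hκ : c - α / 2 ^ k < 0 := by linarith
  have hlin : Tendsto (fun n : ℕ => (2 : ℝ)⁻¹ ^ k + (c - α / 2 ^ k) * n) atTop atBot :=
    tendsto_atBot_add_const_left _ _
      ((tendsto_natCast_atTop_atTop (R := ℝ)).const_mul_atTop_of_neg hκ)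
  have hexp := (Real.tendsto_exp_atBot.comp hlin).eventually (ge_mem_nhds hε)
  filter_upwards [hexp, eventually_ge_atTop 1] with n hsmall hn1
  intro m hm g hg
  have hpos : (0 : ℝ) < Fintype.card (Fin m → Fin k → Fin n × Bool) := by
    have : 0 < n := hn1
    have : Nonempty (Fin n) := ⟨⟨0, this⟩⟩
    exact_mod_cast Fintype.card_pos
  rw [div_le_iff₀ hpos]
  refine (shwAff_successCount_le_of_card_image g _ le_rfl).trans ?_
  rw [← mul_assoc]
  refine mul_le_mul_of_nonneg_right ?_ hpos.le
  have hρ0 : (0 : ℝ) ≤ (1 - (2 : ℝ)⁻¹ ^ k) ^ m := by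
    apply pow_nonneg
    rw [sub_nonneg]
    exact pow_le_one₀ (by norm_num) (by norm_num)
  have hsub : α * n - 1 ≤ (m : ℝ) := by
    have : α * n < (m : ℝ) + 1 := by
      rw [hm]
      exact Nat.lt_floor_add_one _
    linarith
  calc ((((univ : Finset (Fin m → Fin k → Fin n × Bool)).image g).card : ℕ) : ℝ) *
        (1 - (2 : ℝ)⁻¹ ^ k) ^ m
      ≤ Real.exp (c * n) * Real.exp (-(m : ℝ) / 2 ^ k) :=
        mul_le_mul hg (shwAff_pow_le_exp k m) hρ0 (Real.exp_pos _).le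
    _ ≤ Real.exp (c * n) * Real.exp (-(α * n - 1) / 2 ^ k) := by
        refine mul_le_mul_of_nonneg_left (Real.exp_le_exp.2 ?_) (Real.exp_pos _).le
        exact div_le_div_of_nonneg_right (by linarith) h2k.le
    _ = Real.exp ((2 : ℝ)⁻¹ ^ k + (c - α / 2 ^ k) * n) := by
        rw [← Real.exp_add, inv_pow]
        congr 1
        field_simp
        ring
    _ ≤ ε := hsmall

/-- **The algebraic rung for the crux's hardness conjunct (verbatim shape).** For ANY
`f : List Bool → List Bool` (no complexity hypothesis) whose decoded assignment is, eventually in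
`n`, a GF(2)-affine function of the literal polarities for each fixed variable skeleton, and any
`α > 1` (so in particular in the Bresler–Huang window `α_k = 5·2^k log k / k`, `k ≥ 2`), the
hardness conjunct of `SearchHardWindow` holds for `f` at `(k, α)`. -/
theorem shwAff_hardnessConjunct_of_signAffine (k : ℕ) {α : ℝ} (hα : 1 < α)
    (f : List Bool → List Bool)
    (hf : ∀ᶠ n : ℕ in atTop, ∀ m : ℕ, m = ⌊α * n⌋₊ →
      ∀ (S : Fin m → Fin k → Fin n) (x y z : Fin m → Fin k → Bool) (v : Fin n),
        (f (encodingCNF.encode (List.ofFn fun a => List.ofFn fun b =>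
            (((S a b : Fin n) : ℕ), (x a b ^^ y a b) ^^ z a b)))).getD v false =
          (((f (encodingCNF.encode (List.ofFn fun a => List.ofFn fun b =>
              (((S a b : Fin n) : ℕ), x a b)))).getD v false ^^
            (f (encodingCNF.encode (List.ofFn fun a => List.ofFn fun b =>
              (((S a b : Fin n) : ℕ), y a b)))).getD v false) ^^
            (f (encodingCNF.encode (List.ofFn fun a => List.ofFn fun b =>
              (((S a b : Fin n) : ℕ), z a b)))).getD v false)) :
    ∀ ε : ℝ, 0 < ε → ∀ᶠ n : ℕ in Filter.atTop, ∀ m : ℕ, m = ⌊α * n⌋₊ →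
      ((Finset.univ.filter fun Φ : Fin m → Fin k → Fin n × Bool => ∀ i, ∃ j,
          (f (Literature.Computability.Complexity.encodingCNF.encode (List.ofFn fun a =>
            List.ofFn fun b => (((Φ a b).1 : ℕ), (Φ a b).2)))).getD (Φ i j).1 false =
              (Φ i j).2).card : ℝ) / Fintype.card (Fin m → Fin k → Fin n × Bool) ≤ ε := by
  intro ε hε
  filter_upwards [shwAff_affineMapsFail k hα ε hε, hf] with n hn hfn
  intro m hm
  exact hn m hm (fun Φ v => (f (encodingCNF.encode (List.ofFn fun a => List.ofFn fun b =>
    (((Φ a b).1 : ℕ), (Φ a b).2)))).getD v false) (hfn m hm)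

/-- The Bresler–Huang window density exceeds `1`: `1 < 5·2^k log k / k` for `k ≥ 2`. -/
theorem shwAff_one_lt_windowDensity {k : ℕ} (hk : 2 ≤ k) :
    (1 : ℝ) < 5 * 2 ^ k * Real.log k / k := by
  have hk0 : (0 : ℝ) < k := by exact_mod_cast (lt_of_lt_of_le (by norm_num) hk)
  have hlog : Real.log 2 ≤ Real.log k :=
    Real.log_le_log (by norm_num) (by exact_mod_cast hk)
  have hlog2 : (0.6931471803 : ℝ) < Real.log 2 := Real.log_two_gt_d9
  have hpow : (k : ℝ) ≤ 2 ^ k := by exact_mod_cast Nat.lt_two_pow_self.le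
  rw [lt_div_iff₀ hk0]
  nlinarith [hlog, hlog2, hpow, hk0]

/-- **The algebraic rung in the window (verbatim hardness conjunct of `SearchHardWindow` at
`(k, α_k)`, `α_k = 5·2^k log k / k`, every `k ≥ 2`)** for any `f` whose decoded assignment is
eventually sign-affine. -/
theorem shwAff_hardnessConjunct_window (k : ℕ) (hk : 2 ≤ k) (f : List Bool → List Bool)
    (hf : ∀ᶠ n : ℕ in atTop, ∀ m : ℕ, m = ⌊5 * 2 ^ k * Real.log k / k * n⌋₊ →
      ∀ (S : Fin m → Fin k → Fin n) (x y z : Fin m → Fin k → Bool) (v : Fin n),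
        (f (encodingCNF.encode (List.ofFn fun a => List.ofFn fun b =>
            (((S a b : Fin n) : ℕ), (x a b ^^ y a b) ^^ z a b)))).getD v false =
          (((f (encodingCNF.encode (List.ofFn fun a => List.ofFn fun b =>
              (((S a b : Fin n) : ℕ), x a b)))).getD v false ^^
            (f (encodingCNF.encode (List.ofFn fun a => List.ofFn fun b =>
              (((S a b : Fin n) : ℕ), y a b)))).getD v false) ^^
            (f (encodingCNF.encode (List.ofFn fun a => List.ofFn fun b =>
              (((S a b : Fin n) : ℕ), z a b)))).getD v false)) :
    ∀ ε : ℝ, 0 < ε → ∀ᶠ n : ℕ in Filter.atTop, ∀ m : ℕ, m = ⌊5 * 2 ^ k * Real.log k / k * n⌋₊ →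
      ((Finset.univ.filter fun Φ : Fin m → Fin k → Fin n × Bool => ∀ i, ∃ j,
          (f (Literature.Computability.Complexity.encodingCNF.encode (List.ofFn fun a =>
            List.ofFn fun b => (((Φ a b).1 : ℕ), (Φ a b).2)))).getD (Φ i j).1 false =
              (Φ i j).2).card : ℝ) / Fintype.card (Fin m → Fin k → Fin n × Bool) ≤ ε :=
  shwAff_hardnessConjunct_of_signAffine k (shwAff_one_lt_windowDensity hk) f hf

/-- **No sign-affine solver at any density `α > 1`** (calibration of crux `stmt-PneNP-2463`,
whose hypothesis `Solvable k α` asks for success `≥ ε` infinitely often): for sign-affine `f` the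
success ratio is NOT `≥ ε` infinitely often, for any `ε > 0`. -/
theorem shwAff_not_solvable_of_signAffine (k : ℕ) {α : ℝ} (hα : 1 < α)
    (f : List Bool → List Bool)
    (hf : ∀ᶠ n : ℕ in atTop, ∀ m : ℕ, m = ⌊α * n⌋₊ →
      ∀ (S : Fin m → Fin k → Fin n) (x y z : Fin m → Fin k → Bool) (v : Fin n),
        (f (encodingCNF.encode (List.ofFn fun a => List.ofFn fun b =>
            (((S a b : Fin n) : ℕ), (x a b ^^ y a b) ^^ z a b)))).getD v false =
          (((f (encodingCNF.encode (List.ofFn fun a => List.ofFn fun b =>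
              (((S a b : Fin n) : ℕ), x a b)))).getD v false ^^
            (f (encodingCNF.encode (List.ofFn fun a => List.ofFn fun b =>
              (((S a b : Fin n) : ℕ), y a b)))).getD v false) ^^
            (f (encodingCNF.encode (List.ofFn fun a => List.ofFn fun b =>
              (((S a b : Fin n) : ℕ), z a b)))).getD v false)) :
    ¬ ∃ ε : ℝ, 0 < ε ∧ ∃ᶠ n : ℕ in Filter.atTop, ∀ m : ℕ, m = ⌊α * n⌋₊ → ε ≤
        ((Finset.univ.filter fun Φ : Fin m → Fin k → Fin n × Bool => ∀ i, ∃ j,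
          (f (Literature.Computability.Complexity.encodingCNF.encode (List.ofFn fun a =>
            List.ofFn fun b => (((Φ a b).1 : ℕ), (Φ a b).2)))).getD (Φ i j).1 false =
              (Φ i j).2).card : ℝ) / Fintype.card (Fin m → Fin k → Fin n × Bool) := by
  rintro ⟨ε, hε, hfreq⟩
  have hev := shwAff_hardnessConjunct_of_signAffine k hα f hf (ε / 2) (half_pos hε)
  obtain ⟨n, hn1, hn2⟩ := (hfreq.and_eventually hev).exists
  have h1 := hn1 _ rfl
  have h2 := hn2 _ rfl
  linarith

end Asymptotic

end Summit.PneNP.PneNP.Theorems
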